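import Mathlib
import HarnessLib
import Summits.SmoothPoincare4.SmoothPoincare4.Theses.DottedCircleRasmussen
import Summits.SmoothPoincare4.SmoothPoincare4.Theses.ZeroSurgeryExotic
import Summits.SmoothPoincare4.SmoothPoincare4.Theorems.ZseSVanishesOnPairs.Negative.Targets
import Literature.Topology.FourManifolds.MMSWRasmussenFacts
import Literature.Topology.FourManifolds.HomotopyBallSlice

/-!
# Crux `DcrRigidity` (stmt-SmoothPoincare4-17014) — ideator r1/k1 sketch

First lemmas of the two idea cards filed by `planner-cruxidea-stmt-SmoothPoincare4-17014-1-0`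
(round 1, ideator 1). Nothing here is a proof of the crux; `sorry` marks the statements a
crux-plan would register as stubs. Everything is stated over existing declarations.

* Card `planar-cut-along-sum-sphere`: `PlanarHBS → DcrRigidity` (`dcrRigidity_of_planarHBS`),
  and the k = 0 lower edge `ZseHsliceNotSlice → DcrGap` (`dcrGap_of_zseHsliceNotSlice`,
  provable now), hence `DcrRigidity → ∀ K, IsHomotopyBallSlice K → IsSmoothlySlice K`.
* Card `cork-off-the-datum`: `LocallyStandardNearData → DcrRigidity`
  (`dcrRigidity_of_locallyStandardNearData`), the rebuild lemma the cork line ends in.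
-/

noncomputable section

set_option linter.dupNamespace false

open scoped Manifold ContDiff Topology
open Set Function ContinuousMap
open Literature.Topology.FourManifolds

namespace Summit.SmoothPoincare4.SmoothPoincare4.Cruxes.DcrRigidity.IdeatorR1K1

/-- Local notation: `𝔼 n` is the model Euclidean space `EuclideanSpace ℝ (Fin n)`. -/
local notation "𝔼 " n:arg => EuclideanSpace ℝ (Fin n)

/-- Local notation: `𝕊 n` is the unit sphere in `EuclideanSpace ℝ (Fin (n + 1))`. -/
local notation "𝕊 " n:arg => (Metric.sphere (0 : EuclideanSpace ℝ (Fin (n + 1))) 1)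

open Summit.SmoothPoincare4.SmoothPoincare4.Theses.DottedCircleRasmussen (DcrGap DcrRigidity)
open Summit.SmoothPoincare4.SmoothPoincare4.Theses.ZeroSurgeryExotic (ZseHsliceNotSlice)

/-! ## Card A — planar cut along the sum sphere: `PlanarHBS → DcrRigidity` -/

/-- The Swiss-cheese model of a compact planar surface with `m + 1` boundary circles: the closed
unit disc minus `m` open round holes with centres `c i` and radii `ρ i`. -/
def planarDomain {m : ℕ} (c : Fin m → 𝔼 2) (ρ : Fin m → ℝ) : Set (𝔼 2) :=
  {x | ‖x‖ ≤ 1 ∧ ∀ i, ρ i ≤ ‖x - c i‖}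

/-- Its interior. -/
def planarInterior {m : ℕ} (c : Fin m → 𝔼 2) (ρ : Fin m → ℝ) : Set (𝔼 2) :=
  {x | ‖x‖ < 1 ∧ ∀ i, ρ i < ‖x - c i‖}

/-- Its boundary: the outer unit circle and the `m` hole circles. -/
def planarBoundary {m : ℕ} (c : Fin m → 𝔼 2) (ρ : Fin m → ℝ) : Set (𝔼 2) :=
  {x | ‖x‖ = 1 ∨ ∃ i, ‖x - c i‖ = ρ i} ∩ planarDomain c ρ

/-- Admissible holes: positive radii, closed holes inside the open unit disc, pairwise disjoint
closures — so that `planarDomain c ρ` is a compact planar surface with `m + 1` boundary circles. -/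
def AdmissibleHoles {m : ℕ} (c : Fin m → 𝔼 2) (ρ : Fin m → ℝ) : Prop :=
  (∀ i, 0 < ρ i ∧ ‖c i‖ + ρ i < 1) ∧ ∀ i j, i ≠ j → ρ i + ρ j < ‖c i - c j‖

/-- A system of `n` pairwise disjoint smooth properly embedded PLANAR surfaces in `X` hanging off
the ball `e(𝔻⁴)`: component `a` is the Swiss-cheese domain with `m a` holes, mapped by `g a`
(`C^∞` on `ℝ²`, injective and immersive on the domain), its interior into `X ∖ e(𝔻⁴)` and its
boundary circles onto the prescribed curves `e ∘ lam a` on the sphere `e(S³)`. The combinatorial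
TYPE of the system (number of components, holes per component, labelled boundary data) is the
tuple `(n, m, c, ρ, lam)`, shared between hypothesis and conclusion of `PlanarHBS`. -/
def IsPlanarSystemOffBall (X : Type*) [TopologicalSpace X] [ChartedSpace (𝔼 4) X]
    (e : 𝔼 4 → X) {n : ℕ} (m : Fin n → ℕ) (c : ∀ a, Fin (m a) → 𝔼 2) (ρ : ∀ a, Fin (m a) → ℝ)
    (lam : Fin n → 𝔼 2 → 𝔼 4) (g : Fin n → 𝔼 2 → X) : Prop :=
  (∀ a, AdmissibleHoles (c a) (ρ a)) ∧
  (∀ a, ContMDiff (𝓡 2) (𝓡 4) ∞ (g a)) ∧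
  (∀ a, InjOn (g a) (planarDomain (c a) (ρ a))) ∧
  (∀ a, ∀ x ∈ planarDomain (c a) (ρ a), Injective (mfderiv (𝓡 2) (𝓡 4) (g a) x)) ∧
  (∀ a, ∀ x ∈ planarInterior (c a) (ρ a), g a x ∉ e '' Metric.closedBall (0 : 𝔼 4) 1) ∧
  (∀ a, ∀ x ∈ planarBoundary (c a) (ρ a), ‖lam a x‖ = 1 ∧ g a x = e (lam a x)) ∧
  (∀ a b, a ≠ b → Disjoint (g a '' planarDomain (c a) (ρ a)) (g b '' planarDomain (c b) (ρ b)))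

/-- **PlanarHBS** ("planar surfaces that are H-slice in a homotopy ball are slice in `B⁴`,
type-preservingly"): for every homotopy 4-sphere `M` (the Statement's binders), every smooth
chart `e : ℝ⁴ ↪ M`, and every planar system hanging off `e(𝔻⁴)` in the homotopy ball
`M ∖ e(B̊⁴)` with boundary data `lam` on `S³`, there is a planar system OF THE SAME TYPE with the
same boundary data hanging off the unit ball in `ℝ⁴` (equivalently in `B⁴ = S⁴ ∖ B̊⁴`).
It is the geometric statement whose `s`-shadow is MMSW Question 9.11 (strongly slice links in
homotopy 4-spheres); SPC4 implies it (Palais); it implies `DcrRigidity` (below) and the knot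
case `n = 1, m = 0` is "H-slice ⇒ slice". [cite: ManolescuMarengonSarkarWillis2023, Question 9.11]
[cite: FreedmanGompfMorrisonWalker2010, §1] -/
def PlanarHBS : Prop :=
  ∀ (M : Type) [TopologicalSpace M] [T2Space M] [SecondCountableTopology M]
    [ChartedSpace (𝔼 4) M] [IsManifold (𝓡 4) ∞ M],
    Nonempty (M ≃ₕ 𝕊 4) →
  ∀ (e : 𝔼 4 → M), Manifold.IsSmoothEmbedding (𝓡 4) (𝓡 4) ∞ e →
  ∀ (n : ℕ) (m : Fin n → ℕ) (c : ∀ a, Fin (m a) → 𝔼 2) (ρ : ∀ a, Fin (m a) → ℝ)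
    (lam : Fin n → 𝔼 2 → 𝔼 4) (g : Fin n → 𝔼 2 → M),
    IsPlanarSystemOffBall M e m c ρ lam g →
    ∃ g' : Fin n → 𝔼 2 → 𝔼 4, IsPlanarSystemOffBall (𝔼 4) id m c ρ lam g'

/-- **Card A, first lemma (the reduction; apex of the line is `PlanarHBS` itself).**
Cut the slice disc `f(𝔻²) ⊂ M ∖ e(D_k)` along the sphere `e(S³_R)` (`R` a regular value of
`‖e⁻¹ ∘ f‖` just above the model radius, Sard): the part inside `e(B_R) ∖ e(D_k)` is already
standard (pull back by `e`, push into `S⁴` by the stereographic chart), the part outside is a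
planar system hanging off `e(B̄_R)` in the homotopy ball `M ∖ e(B̊_R)`; `PlanarHBS` (rescaled)
replaces it by a system of the same type off `B̄_R ⊂ ℝ⁴`; same type ⇒ the re-glued surface is
again a disc (Euler characteristic and connectivity are type invariants), smooth after
straightening collars. [cite: ManolescuMarengonSarkarWillis2023, Question 9.11] -/
theorem dcrRigidity_of_planarHBS (h : PlanarHBS) : DcrRigidity := by
  sorry

/-- **Card A, lower edge (provable now, k = 0): an H-slice-not-slice knot is a one-handle slice
gap with no one-handles.** Transport `K ⊂ S³` to the ellipsoid `∂D_0 = {(x₀²+x₁²)/40² + x₂² + x₃² = 1}`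
by the linear map `L = diag(40, 40, 1, 1)` (`L(𝔻⁴) = D_0`): the datum `(M, e ∘ L⁻¹, f)` is a
`DcrGap` datum for `(0, L ∘ K)`, and a disc in `N ∖ e'(D_0)`, `N ≅ S⁴`, is a slice disc in `B⁴`
by `isSmoothlySlice_of_isSliceDiscIn_of_diffeomorph_sphere` applied to `(e' ∘ L, f')`.
Contrapositive: `DcrRigidity → ∀ K, K.IsHomotopyBallSlice → K.IsSmoothlySlice`.
[cite: FreedmanGompfMorrisonWalker2010, §1] -/
theorem dcrGap_of_zseHsliceNotSlice (h : ZseHsliceNotSlice) : DcrGap := by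
  sorry

/-- Contrapositive packaging of the lower edge (pure logic over the previous lemma and the
tree's `ZeroSurgeryExoticZseHsliceNotSlicePosition`-style unfolding). -/
theorem knotHBS_of_dcrRigidity (h₀ : ZseHsliceNotSlice → DcrGap) (h : DcrRigidity) :
    ∀ K : Knot, K.IsHomotopyBallSlice → K.IsSmoothlySlice := by
  intro K hK
  by_contra hs
  exact h (h₀ ⟨K, hK, hs⟩)

/-! ## Card B — cork off the datum: the rebuild lemma `LocallyStandardNearData → DcrRigidity` -/

/-- A radius with `D_k ⊂ B(0, modelRadius k − 1)`: on `D_k = {G_k ≤ 1}` one has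
`x₀² + x₁² ≤ (40(k+1))²` and `x₂² + x₃² ≤ 1`. -/
def modelRadius (k : ℕ) : ℝ := 40 * ((k : ℝ) + 1) + 2

/-- The model handlebody sits inside the ball of radius `modelRadius k − 1` (elementary; the
hole terms of `levelFun` are nonnegative). [folklore] -/
theorem modelHandlebody_subset_ball (k : ℕ) :
    MMSW.modelHandlebody k ⊆ Metric.ball (0 : 𝔼 4) (modelRadius k - 1) := by
  sorry

/-- **Locally standard near the datum**: for every `DcrGap`-type datum `(k, K, M, e, f)` some open
`U ⊆ M` containing the chart ball `e(B̄(0, modelRadius k))` and the disc `f(𝔻²)` embeds smoothly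
in `S⁴`. This is what a cork `(C, τ)` of `M` (to `S⁴`) DISJOINT from `e(B̄) ∪ f(𝔻²)` delivers
(`U := M ∖ C`, `ι :=` the inclusion of `M ∖ C` into the twisted manifold `≅ S⁴`), and also what
an inverse `M # M' ≅ S⁴` delivers (`U := M ∖ {far point}`); SPC4 ⇒ it (`U := ⊤`). -/
def LocallyStandardNearData : Prop :=
  ∀ (k : ℕ) (K : 𝕊 1 → 𝔼 4), MMSW.IsModelKnot k K →
  ∀ (M : Type) [TopologicalSpace M] [T2Space M] [SecondCountableTopology M]
    [ChartedSpace (𝔼 4) M] [IsManifold (𝓡 4) ∞ M], Nonempty (M ≃ₕ 𝕊 4) →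
  ∀ (e : 𝔼 4 → M) (f : 𝔼 2 → M), MMSW.IsSliceDiscInComplement k K M e f →
  ∃ U : TopologicalSpace.Opens M,
    e '' Metric.closedBall (0 : 𝔼 4) (modelRadius k) ⊆ (U : Set M) ∧
    f '' Metric.closedBall (0 : 𝔼 2) 1 ⊆ (U : Set M) ∧
    ∃ ι : U → 𝕊 4, Manifold.IsSmoothEmbedding (𝓡 4) (𝓡 4) ∞ ι

/-- **Card B, first lemma (the rebuild; provable now, M-sized).** From `ι : U ↪ S⁴` build the
standard-side datum: `e' := ι ∘ e ∘ s` with `s : ℝ⁴ → B̊(0, modelRadius k)` a radial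
diffeomorphism onto fixing `B̄(0, modelRadius k − 1) ⊇ D_k` pointwise (so `e'(D_k) = ι(e(D_k))`
and `e' ∘ K = ι ∘ e ∘ K`), and `f' := ι ∘ f ∘ r` with `r : ℝ² → B̊(0, 1 + ε) ⊆ f⁻¹(U)` radial,
the identity on `𝔻²`; `N := S⁴`. All six clauses of `IsSliceDiscInComplement` transport along
the smooth embedding `ι` exactly as in the proved `DcrTransport` / `IsSliceDiscIn.comp_isSmoothEmbedding`. -/
theorem dcrRigidity_of_locallyStandardNearData (h : LocallyStandardNearData) : DcrRigidity := by
  sorry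

/-- SPC4 ⇒ `LocallyStandardNearData` (take `U = ⊤`): the hypothesis of Card B's rebuild lemma is
SPC4-implied (§D.1 of the barrier catalogue), as every statement on this crux must be. -/
theorem locallyStandardNearData_of_spc4 (hS : _root_.SmoothPoincare4) : LocallyStandardNearData := by
  intro k K hK M _ _ _ i4 i5 hM e f hef
  obtain ⟨h⟩ := hM
  obtain ⟨Φ⟩ := hS M i4 i5 h
  refine ⟨⊤, fun _ _ ↦ trivial, fun _ _ ↦ trivial, fun x ↦ Φ x.1, ?_⟩
  -- `Φ ∘ Subtype.val` on the open submanifold `⊤`: a smooth embedding (diffeomorphism composed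
  -- with the inclusion of an open subset, `Manifold.IsSmoothEmbedding.of_opens`-style); left
  -- to the prover.
  sorry

end Summit.SmoothPoincare4.SmoothPoincare4.Cruxes.DcrRigidity.IdeatorR1K1
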